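/-
Copyright (c) 2026. All rights reserved.
Released under Apache 2.0 license as described in the file LICENSE.
Authors: abc-iut cell, seat abc-iut-L4-t9 (gen 5; [AbsTopIII] Def 3.1 (iv), Prop 3.2 (v) on abstract pairs).
-/
import Literature.AnabelianGeometry.AbsoluteAnabelian.MLFGaloisNaturalFunctorsCompat
import Literature.AnabelianGeometry.AbsoluteAnabelian.MLFGaloisNaturalFunctorsFaithful
import Mathlib.CategoryTheory.Equivalence

/-!
# [AbsTopIII] Def 3.1 (iv) log-Frobenius functors and the 1-factorization of Prop 3.2 (v) — on ABSTRACT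
# MLF-Galois pairs, with "the algorithm of (iii)" as an explicit parameter

S. Mochizuki, *Topics in absolute anabelian geometry III* [MochizukiAbsTopIII2015] (kurims manuscript
`paper:url-5493eb38cbb7`, read on the page).  Def 3.1 (iv) pp. 68–69: "the construction that assigns (the
ind-topological field `k̄`, with its natural `Π_k`-action) `↦` (the ind-topological field `k~`, with its natural
`Π_k`-action) determines a natural functor `𝔩𝔬𝔤_{TF,TF} : 𝒞^MLF_TF → 𝒞^MLF_TF` [...] Since `log_k̄` determines a
functorial isomorphism between the fields `k̄`, `k~`, it follows immediately that the functor `𝔩𝔬𝔤_{TF,TF}` is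
isomorphic to the identity functor [hence, in particular, is an equivalence of categories].  By composing
`𝔩𝔬𝔤_{TF,TF}` with the various natural functors defined in (iii), we also obtain, for `T ∈ {TLG, TCG, TM}`, a
functor `𝔩𝔬𝔤_{TF,T} : 𝒞^MLF_TF → 𝒞^MLF_T`".  Prop 3.2 (iii) p. 72: "Suppose that `(Π ↷ M_T)` is of strictly Belyi
type.  Then the construction of Corollary 1.10, (h), determines an additive structure [...] on the union with
`{0}` of the group generated by the image of the Kummer map [...] these constructions yield a functorial [i.e.,
relative to `𝒞^MLF_T`, in the evident sense] algorithm for constructing this topological field structure."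
Prop 3.2 (v) p. 72 l. 29–42: "The algorithm of (iii) yields a natural [1-]factorization
`𝒞^{MLF-sB}_TF ⟶ 𝒞^{MLF-sB}_T ⟶^{𝔩𝔬𝔤_{T,T′}} 𝒞^{MLF-sB}_{T′}` — where `T′ ∈ {TF, TLG, TCG, TM}`; the first arrow is
the natural functor of Definition 3.1, (iii), if `T = TM`, or the identity functor if `T = TF` — of the ["sB"
versions of the] log-Frobenius functors `𝔩𝔬𝔤_{TF,T′}` [...].  Moreover, the functor `𝔩𝔬𝔤_{T,T}` is isomorphic
to the identity functor [hence, in particular, is an equivalence of categories]."  Proof p. 72 l. 43–45: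
"Assertions (i), (ii), (iii), (v) are immediate from the constructions".

Sub-DAG row P32.v.L18 ("functor level") of `plan/L4/SUBDAG-AbsTopIII-Prop32.md`, over abc-iut-L4-t2's REAL
natural functors on abstract pairs with compact `Π` (`tfToTMCompact`, `tmToTLGCompact`, `tmToTCG`, `tlgToTCG`,
`tmToTLG_tlgToTCG_iso`) and this seat's `MLFGaloisNaturalFunctorsFaithful` (faithful / conservative /
essential image).  Contents:

* (c) Def 3.1 (iv) IN LOG-COORDINATES — MODELLING CHOICE (OURS, the convention of the cell's model file
  `AbsTopIII/MLFLogFrobeniusFunctors`): the output field `k~ = (𝒪^×_k̄)^pf` is IDENTIFIED with `k̄` along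
  print's "functorial isomorphism" `log_k̄`, so `mlfLogFrobeniusTF := 𝟭` ON THE NOSE (`mlfLogFrobeniusTFIsoId`), and
  `mlfLogFrobeniusTFToTM/TLG/TCG` are the composites with the natural functors; the datum NOT invariant under
  this identification (`ι_log`, the pre-log-shell) lives at the MODEL, where the `p`-adic logarithm exists —
  the typed abstract pairs carry no topology (Rmk 3.1.1);
* (d) "the algorithm of (iii)" as DATA over a PARAMETER `S : ObjectProperty 𝒞^c_TF` standing for "of strictly
  Belyi type" (the tree has no étale `π₁`; same device as abc-iut-L4-t5's `TFModel.AnabelianInput` for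
  Cor 3.6): `tmPairsOf S` ("`𝒞^{MLF-S}_TM`" = the `TM`-pairs of `S`-pairs, up to isomorphism), the restricted
  natural functor `tfToTMOn S`, and `Prop32iiiAlgorithm S` = a functor `R : 𝒞^{S}_TM → 𝒞^{S}_TF` with
  `tfToTMOn S ⋙ R ≅ 𝟭` ((iii) "recovers `k̄`", functorially) and `R ⋙ tfToTMOn S ≅ 𝟭`; it is NOT constructed
  and NOT asserted to exist (for mono-analytic pairs `Π = G_k` it does not: `G_k ↷ 𝒪^⊳_k̄` does not determine
  the additive structure);
* over it, the printed sentences of (v): `𝔩𝔬𝔤_{TM,T′}` (`mlfLogFrobeniusTMTo*`), the 1-FACTORIZATIONS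
  `𝔩𝔬𝔤_{TF,T′}|_S ≅ (𝒞_TF → 𝒞_TM) ⋙ 𝔩𝔬𝔤_{TM,T′}` (`factorTF/TM/TLG/TCG`), "`𝔩𝔬𝔤_{TM,TM}` is isomorphic to the
  identity functor" (`mlfLogFrobeniusTMToTMIsoId`), "hence an equivalence" (`equivalence`,
  `isEquivalence_mlfLogFrobeniusTMToTM`);
* (e) THE HONEST RESIDUAL, kernel-pinned: `tfToTMOn S` is FAITHFUL and ESSENTIALLY SURJECTIVE for every
  `S` (unconditional), so `nonempty_prop32iiiAlgorithm_iff_full : Nonempty (Prop32iiiAlgorithm S) ↔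
  (tfToTMOn S).Full` — the algorithm of (iii) exists as a functorial datum on the `S`-pairs IFF every
  morphism `(Π ↷ 𝒪^⊳) → (Π′ ↷ 𝒪′^⊳)` between `S`-pairs extends to the fields; for `S` = "strictly Belyi
  type" that fullness is [AbsTopIII] Prop 3.2 (iii)/(iv) functoriality = Cor 1.10 (h) (campaign-L).

HONEST FRAMING: refereed pre-IUT material; (c) is a declared convention, (d) formal category theory over
an explicit parameter (print: "immediate from the constructions"), (e) our kernel theorem.  No instance, no
notation.  Nothing here bears on [IUTchIII] Cor 3.12 or takes a side; typed ≠ proved for anything downstream.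
-/

noncomputable section

universe u

namespace Literature.AnabelianGeometry.AbsoluteAnabelian

open _root_.CategoryTheory

/-! ## Bookkeeping: the restricted natural functor `𝒞^c_TF → 𝒞^c_TM` is faithful, conservative, essentially surjective -/

/-- The inclusion `𝒞^{MLF,c}_T → 𝒞^MLF_T` (abc-iut-L4-t2's `forget`) is faithful. [cite: MochizukiAbsTopIII2015, Definition 3.1 (iii) p.67] -/
theorem MLFGaloisMonoidPairCompactCat.forget_faithful (T : PairType) :
    (MLFGaloisMonoidPairCompactCat.forget.{u} T).Faithful := by
  constructor
  intro P Q f g h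
  have h' := congrArg InducedCategory.Hom.hom h
  apply InducedCategory.hom_ext
  exact h'

/-- The inclusion `𝒞^{MLF,c}_T → 𝒞^MLF_T` is full. [cite: MochizukiAbsTopIII2015, Definition 3.1 (iii) p.67] -/
theorem MLFGaloisMonoidPairCompactCat.forget_full (T : PairType) :
    (MLFGaloisMonoidPairCompactCat.forget.{u} T).Full :=
  ⟨fun {_ _} f => ⟨InducedCategory.homMk f.hom, rfl⟩⟩

/-- **`𝒞^c_TF → 𝒞^c_TM` is faithful** (from `tfToTM_faithful`). [cite: MochizukiAbsTopIII2015, Proposition 3.2 (v) p.72] -/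
theorem tfToTMCompact_faithful : tfToTMCompact.{u}.Faithful :=
  haveI : (tfToTMCompact.{u} ⋙ MLFGaloisMonoidPairCompactCat.forget .TM).Faithful := by
    rw [tfToTMCompact_comp_forget]; exact tfToTM_faithful
  Functor.Faithful.of_comp tfToTMCompact (MLFGaloisMonoidPairCompactCat.forget .TM)

/-- **`𝒞^c_TF → 𝒞^c_TM` is essentially surjective**: every MLF-Galois `TM`-pair with compact `Π` is the pair of
integers of an MLF-Galois `TF`-pair with compact `Π`, up to isomorphism (`exists_iso_tfToTM_obj`).
[cite: MochizukiAbsTopIII2015, Proposition 3.2 (v) p.72] -/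
theorem tfToTMCompact_essSurj : tfToTMCompact.{u}.EssSurj := by
  refine ⟨fun Q => ?_⟩
  haveI : CompactSpace ((MLFGaloisMonoidPairCompactCat.forget .TM).obj Q).obj.Pi := Q.property.2
  obtain ⟨P, ⟨i⟩⟩ := exists_iso_tfToTM_obj ((MLFGaloisMonoidPairCompactCat.forget .TM).obj Q)
  have h₁ := congrArg InducedCategory.Hom.hom i.hom_inv_id
  have h₂ := congrArg InducedCategory.Hom.hom i.inv_hom_id
  let i' : (tfToTMCompact.obj P).obj ≅ Q.obj := ⟨i.hom.hom, i.inv.hom, h₁, h₂⟩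
  exact ⟨P, ⟨ObjectProperty.isoMk _ i'⟩⟩

/-- **`𝒞^c_TF → 𝒞^c_TM` reflects isomorphisms** (from `isIso_of_isIso_tfToTM_map`).
[cite: MochizukiAbsTopIII2015, Proposition 3.2 (v) p.72] -/
theorem tfToTMCompact_reflectsIsomorphisms : tfToTMCompact.{u}.ReflectsIsomorphisms := by
  constructor
  intro P Q φ h
  haveI : IsIso (tfToTM.map φ) := by
    change IsIso ((MLFGaloisMonoidPairCompactCat.forget .TM).map (tfToTMCompact.map φ))
    exact Functor.map_isIso (MLFGaloisMonoidPairCompactCat.forget .TM) (tfToTMCompact.map φ)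
  exact isIso_of_isIso_tfToTM_map φ

/-! ## (c) Def 3.1 (iv): the log-Frobenius functors `𝔩𝔬𝔤_{TF,T′}` on abstract pairs, in log-coordinates -/

/-- **Def 3.1 (iv), `𝔩𝔬𝔤_{TF,TF} : 𝒞_TF → 𝒞_TF` IN LOG-COORDINATES** (on MLF-Galois `TF`-pairs with compact `Π`).
Print: the assignment `(Π_k ↷ k̄) ↦ (Π_k ↷ k~)` "determines a natural functor `𝔩𝔬𝔤_{TF,TF}` [...] Since `log_k̄`
determines a functorial isomorphism between the fields `k̄`, `k~`, it follows immediately that the functor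
`𝔩𝔬𝔤_{TF,TF}` is isomorphic to the identity functor".  MODELLING CHOICE (OURS, as in the cell's model file
`AbsTopIII/MLFLogFrobeniusFunctors`): `k~ = (𝒪^×_k̄)^pf` is IDENTIFIED with `k̄` along that functorial
isomorphism, so the functor is `𝟭` ON THE NOSE; the non-invariant datum — `ι_log : (k~)^× ↪ (k̄^×)^pf` and
the pre-log-shell — is carried by the MODEL (`TFModel.iotaLog`, `LogFrobeniusOutput.shell`), where the
`p`-adic logarithm exists (the typed abstract pairs carry no topology, Rmk 3.1.1).
[cite: MochizukiAbsTopIII2015, Definition 3.1 (iv) p.68] -/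
def mlfLogFrobeniusTF : MLFGaloisFieldPairCompactCat.{u} ⥤ MLFGaloisFieldPairCompactCat.{u} := 𝟭 _

/-- **Def 3.1 (iv): "`𝔩𝔬𝔤_{TF,TF}` is isomorphic to the identity functor"** (in log-coordinates: equal).
[cite: MochizukiAbsTopIII2015, Definition 3.1 (iv) p.69] -/
def mlfLogFrobeniusTFIsoId : mlfLogFrobeniusTF.{u} ≅ 𝟭 _ := Iso.refl _

/-- **Def 3.1 (iv): "hence, in particular, is an equivalence of categories".**
[cite: MochizukiAbsTopIII2015, Definition 3.1 (iv) p.69] -/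
theorem isEquivalence_mlfLogFrobeniusTF : mlfLogFrobeniusTF.{u}.IsEquivalence :=
  inferInstanceAs ((𝟭 MLFGaloisFieldPairCompactCat.{u}).IsEquivalence)

/-- **Def 3.1 (iv), `𝔩𝔬𝔤_{TF,TM}`**: "By composing `𝔩𝔬𝔤_{TF,TF}` with the various natural functors defined in
(iii), we also obtain, for `T ∈ {TLG, TCG, TM}`, a functor `𝔩𝔬𝔤_{TF,T} : 𝒞^MLF_TF → 𝒞^MLF_T`" — here `T = TM`.
[cite: MochizukiAbsTopIII2015, Definition 3.1 (iv) p.69] -/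
def mlfLogFrobeniusTFToTM : MLFGaloisFieldPairCompactCat.{u} ⥤ MLFGaloisMonoidPairCompactCat.{u} .TM :=
  mlfLogFrobeniusTF ⋙ tfToTMCompact

/-- **Def 3.1 (iv), `𝔩𝔬𝔤_{TF,TLG}`** (composite with `𝒞_TF → 𝒞_TM → 𝒞_TLG`).
[cite: MochizukiAbsTopIII2015, Definition 3.1 (iv) p.69] -/
def mlfLogFrobeniusTFToTLG : MLFGaloisFieldPairCompactCat.{u} ⥤ MLFGaloisMonoidPairCompactCat.{u} .TLG :=
  mlfLogFrobeniusTF ⋙ tfToTMCompact ⋙ tmToTLGCompact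

/-- **Def 3.1 (iv), `𝔩𝔬𝔤_{TF,TCG}`** (composite with `𝒞_TF → 𝒞_TM → 𝒞_TCG`).
[cite: MochizukiAbsTopIII2015, Definition 3.1 (iv) p.69] -/
def mlfLogFrobeniusTFToTCG : MLFGaloisFieldPairCompactCat.{u} ⥤ MLFGaloisMonoidPairCat.{u} .TCG :=
  mlfLogFrobeniusTF ⋙ tfToTMCompact ⋙ MLFGaloisMonoidPairCompactCat.forget .TM ⋙ tmToTCG

/-- `𝔩𝔬𝔤_{TF,TCG}` through `𝒞_TLG` instead ("compatible natural functors": abc-iut-L4-t2's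
`tmToTLG_tlgToTCG_iso`, whiskered). [cite: MochizukiAbsTopIII2015, Definition 3.1 (iv) p.69] -/
def mlfLogFrobeniusTFToTCGIsoViaTLG :
    mlfLogFrobeniusTFToTCG.{u} ≅ mlfLogFrobeniusTF ⋙ tfToTMCompact ⋙ tmToTLGCompact ⋙ tlgToTCG :=
  Functor.isoWhiskerLeft mlfLogFrobeniusTF (Functor.isoWhiskerLeft tfToTMCompact tmToTLG_tlgToTCG_iso)

/-! ## (d) Prop 3.2 (v): the 1-factorization through `𝒞_TM`, over "the algorithm of (iii)" as a parameter -/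

variable (S : ObjectProperty MLFGaloisFieldPairCompactCat.{u})

/-- **"`𝒞^{MLF-S}_TM`"**: the MLF-Galois `TM`-pairs (compact `Π`) isomorphic to the pair of integers of an
`S`-pair — for `S` = "of strictly Belyi type" (a condition on `Π ↠ G` only, shared by `(Π ↷ k̄)` and
`(Π ↷ 𝒪^⊳_k̄)`), print's `𝒞^{MLF-sB}_TM`, read up to isomorphism of pairs.
[cite: MochizukiAbsTopIII2015, Definition 3.1 (iii) p.68] -/
def tmPairsOf : ObjectProperty (MLFGaloisMonoidPairCompactCat.{u} .TM) :=
  fun Q => ∃ P : MLFGaloisFieldPairCompactCat.{u}, S P ∧ Nonempty (tfToTMCompact.obj P ≅ Q)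

/-- **The natural functor `𝒞^{MLF-S}_TF → 𝒞^{MLF-S}_TM`** ("the first arrow is the natural functor of
Definition 3.1, (iii), if `T = TM`"), restriction of `tfToTMCompact`. [cite: MochizukiAbsTopIII2015, Proposition 3.2 (v) p.72] -/
def tfToTMOn : S.FullSubcategory ⥤ (tmPairsOf S).FullSubcategory :=
  ObjectProperty.lift _ (S.ι ⋙ tfToTMCompact) fun P => ⟨P.obj, P.property, ⟨Iso.refl _⟩⟩

/-- `tfToTMOn S` is `tfToTMCompact` on underlying objects (definitionally). [cite: MochizukiAbsTopIII2015, Proposition 3.2 (v) p.72] -/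
def tfToTMOnCompιIso : tfToTMOn S ⋙ (tmPairsOf S).ι ≅ S.ι ⋙ tfToTMCompact := Iso.refl _

/-- **`𝒞^{MLF-S}_TF → 𝒞^{MLF-S}_TM` is faithful**, for every `S` (unconditional).
[cite: MochizukiAbsTopIII2015, Proposition 3.2 (v) p.72] -/
theorem tfToTMOn_faithful : (tfToTMOn S).Faithful := by
  haveI := tfToTMCompact_faithful.{u}
  haveI : (S.ι ⋙ tfToTMCompact).Faithful := Functor.Faithful.comp _ _
  unfold tfToTMOn
  infer_instance

/-- **`𝒞^{MLF-S}_TF → 𝒞^{MLF-S}_TM` is essentially surjective**, for every `S` (by the definition of `tmPairsOf`).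
[cite: MochizukiAbsTopIII2015, Proposition 3.2 (v) p.72] -/
theorem tfToTMOn_essSurj : (tfToTMOn S).EssSurj := by
  refine ⟨fun Q => ?_⟩
  obtain ⟨P, hP, ⟨i⟩⟩ := Q.property
  exact ⟨⟨P, hP⟩, ⟨ObjectProperty.isoMk _ i⟩⟩

/-- `𝒞^{MLF-S}_TF → 𝒞^{MLF-S}_TM` reflects isomorphisms, for every `S`.
[cite: MochizukiAbsTopIII2015, Proposition 3.2 (v) p.72] -/
theorem tfToTMOn_reflectsIsomorphisms : (tfToTMOn S).ReflectsIsomorphisms := by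
  constructor
  intro P Q φ h
  haveI := tfToTMCompact_reflectsIsomorphisms.{u}
  haveI : IsIso (tfToTMCompact.map (S.ι.map φ)) := by
    change IsIso ((tmPairsOf S).ι.map ((tfToTMOn S).map φ))
    exact Functor.map_isIso (tmPairsOf S).ι ((tfToTMOn S).map φ)
  haveI : IsIso (S.ι.map φ) := isIso_of_reflects_iso (S.ι.map φ) tfToTMCompact
  exact isIso_of_fully_faithful S.ι φ

/-- **Prop 3.2 (iii)/(v): "the algorithm of (iii)" on the `S`-pairs, as DATA** — a PARAMETER, NOT constructed
and NOT asserted to exist.  Print, (iii): "Suppose that `(Π ↷ M_T)` is of strictly Belyi type.  Then the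
construction of Corollary 1.10, (h), determines an additive structure [hence, in particular, a topological
field structure] on the union with `{0}` of the group generated by the image of the Kummer map [...] these
constructions yield a functorial [i.e., relative to `𝒞^MLF_T`, in the evident sense] algorithm" — read as a
functor `R : 𝒞^{MLF-S}_TM → 𝒞^{MLF-S}_TF` such that the field reconstructed from the integers of a `TF`-pair
IS that pair (`unitIso`; object level = abc-iut-L4-t2's `MonoidKummerTheory.RecoversClosure`) and the integers
of the reconstructed field are the given monoid (`counitIso`), naturally.  For `S` = strictly Belyi type this
is [AbsTopIII] Cor 1.10 (h) (campaign-L); cf. `nonempty_prop32iiiAlgorithm_iff_full` for exactly what it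
amounts to.  Same role as abc-iut-L4-t5's `TFModel.AnabelianInput` (Cor 3.6).
[cite: MochizukiAbsTopIII2015, Proposition 3.2 (iii) p.72] -/
structure Prop32iiiAlgorithm : Type (u + 1) where
  /-- "the algorithm of (iii)": `(Π ↷ 𝒪^⊳) ↦ (Π ↷ k̄_reconstructed)`, functorially on the `S`-pairs. -/
  R : (tmPairsOf S).FullSubcategory ⥤ S.FullSubcategory
  /-- the field reconstructed from the integers of `(Π ↷ k̄)` is `(Π ↷ k̄)`, naturally. -/
  unitIso : tfToTMOn S ⋙ R ≅ 𝟭 _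
  /-- the integers of the field reconstructed from `(Π ↷ M)` are `(Π ↷ M)`, naturally. -/
  counitIso : R ⋙ tfToTMOn S ≅ 𝟭 _

namespace Prop32iiiAlgorithm

variable {S}

/-- **Prop 3.2 (v): `𝒞^{MLF-S}_TF ≌ 𝒞^{MLF-S}_TM`** — the natural functor of Def 3.1 (iii) and the algorithm of
(iii) are mutually quasi-inverse (Mathlib's `Equivalence.mk` adjusts the unit for the triangle law).
[cite: MochizukiAbsTopIII2015, Proposition 3.2 (v) p.72] -/
def equivalence (A : Prop32iiiAlgorithm.{u} S) : S.FullSubcategory ≌ (tmPairsOf S).FullSubcategory :=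
  CategoryTheory.Equivalence.mk (tfToTMOn S) A.R A.unitIso.symm A.counitIso

/-- Given the algorithm of (iii), `𝒞^{MLF-S}_TF → 𝒞^{MLF-S}_TM` is an equivalence of categories.
[cite: MochizukiAbsTopIII2015, Proposition 3.2 (v) p.72] -/
theorem isEquivalence_tfToTMOn (A : Prop32iiiAlgorithm.{u} S) : (tfToTMOn S).IsEquivalence :=
  Functor.IsEquivalence.mk' A.R A.unitIso.symm A.counitIso

/-- In particular, given the algorithm of (iii), `𝒞^{MLF-S}_TF → 𝒞^{MLF-S}_TM` is FULL: every morphism of the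
integer pairs extends to the fields. [cite: MochizukiAbsTopIII2015, Proposition 3.2 (v) p.72] -/
theorem full (A : Prop32iiiAlgorithm.{u} S) : (tfToTMOn S).Full :=
  haveI := A.isEquivalence_tfToTMOn
  inferInstance

/-- **Prop 3.2 (v), `𝔩𝔬𝔤_{TM,TF} : 𝒞^{S}_TM → 𝒞_TF`** := (algorithm of (iii)) ⋙ `𝔩𝔬𝔤_{TF,TF}`.
[cite: MochizukiAbsTopIII2015, Proposition 3.2 (v) p.72] -/
def mlfLogFrobeniusTMToTF (A : Prop32iiiAlgorithm.{u} S) : (tmPairsOf S).FullSubcategory ⥤ MLFGaloisFieldPairCompactCat.{u} :=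
  A.R ⋙ S.ι ⋙ mlfLogFrobeniusTF

/-- **Prop 3.2 (v), `𝔩𝔬𝔤_{TM,TM} : 𝒞^{S}_TM → 𝒞^{S}_TM`** := (algorithm of (iii)) ⋙ `𝔩𝔬𝔤_{TF,TM}` (in
log-coordinates `𝔩𝔬𝔤_{TF,TM}|_S` = the natural functor). [cite: MochizukiAbsTopIII2015, Proposition 3.2 (v) p.72] -/
def mlfLogFrobeniusTMToTM (A : Prop32iiiAlgorithm.{u} S) : (tmPairsOf S).FullSubcategory ⥤ (tmPairsOf S).FullSubcategory :=
  A.R ⋙ tfToTMOn S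

/-- **Prop 3.2 (v), `𝔩𝔬𝔤_{TM,TLG} : 𝒞^{S}_TM → 𝒞_TLG`** := (algorithm of (iii)) ⋙ `𝔩𝔬𝔤_{TF,TLG}`.
[cite: MochizukiAbsTopIII2015, Proposition 3.2 (v) p.72] -/
def mlfLogFrobeniusTMToTLG (A : Prop32iiiAlgorithm.{u} S) : (tmPairsOf S).FullSubcategory ⥤ MLFGaloisMonoidPairCompactCat.{u} .TLG :=
  A.R ⋙ S.ι ⋙ mlfLogFrobeniusTFToTLG

/-- **Prop 3.2 (v), `𝔩𝔬𝔤_{TM,TCG} : 𝒞^{S}_TM → 𝒞_TCG`** := (algorithm of (iii)) ⋙ `𝔩𝔬𝔤_{TF,TCG}`.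
[cite: MochizukiAbsTopIII2015, Proposition 3.2 (v) p.72] -/
def mlfLogFrobeniusTMToTCG (A : Prop32iiiAlgorithm.{u} S) : (tmPairsOf S).FullSubcategory ⥤ MLFGaloisMonoidPairCat.{u} .TCG :=
  A.R ⋙ S.ι ⋙ mlfLogFrobeniusTFToTCG

/-- **Prop 3.2 (v), the 1-factorization for `T′ = TF`**: `𝔩𝔬𝔤_{TF,TF}|_S ≅ (𝒞_TF → 𝒞_TM) ⋙ 𝔩𝔬𝔤_{TM,TF}`.
[cite: MochizukiAbsTopIII2015, Proposition 3.2 (v) p.72] -/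
def factorTF (A : Prop32iiiAlgorithm.{u} S) : S.ι ⋙ mlfLogFrobeniusTF.{u} ≅ tfToTMOn S ⋙ A.mlfLogFrobeniusTMToTF :=
  (Functor.leftUnitor _).symm ≪≫ Functor.isoWhiskerRight A.unitIso.symm (S.ι ⋙ mlfLogFrobeniusTF) ≪≫
    Functor.associator (tfToTMOn S) A.R (S.ι ⋙ mlfLogFrobeniusTF)

/-- **Prop 3.2 (v), the 1-factorization for `T′ = TM`**: `𝔩𝔬𝔤_{TF,TM}|_S ≅ (𝒞_TF → 𝒞_TM) ⋙ 𝔩𝔬𝔤_{TM,TM}`.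
[cite: MochizukiAbsTopIII2015, Proposition 3.2 (v) p.72] -/
def factorTM (A : Prop32iiiAlgorithm.{u} S) : tfToTMOn S ≅ tfToTMOn S ⋙ A.mlfLogFrobeniusTMToTM :=
  (Functor.leftUnitor _).symm ≪≫ Functor.isoWhiskerRight A.unitIso.symm (tfToTMOn S) ≪≫
    Functor.associator (tfToTMOn S) A.R (tfToTMOn S)

/-- **Prop 3.2 (v), the 1-factorization for `T′ = TLG`**: `𝔩𝔬𝔤_{TF,TLG}|_S ≅ (𝒞_TF → 𝒞_TM) ⋙ 𝔩𝔬𝔤_{TM,TLG}`.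
[cite: MochizukiAbsTopIII2015, Proposition 3.2 (v) p.72] -/
def factorTLG (A : Prop32iiiAlgorithm.{u} S) : S.ι ⋙ mlfLogFrobeniusTFToTLG.{u} ≅ tfToTMOn S ⋙ A.mlfLogFrobeniusTMToTLG :=
  (Functor.leftUnitor _).symm ≪≫ Functor.isoWhiskerRight A.unitIso.symm (S.ι ⋙ mlfLogFrobeniusTFToTLG) ≪≫
    Functor.associator (tfToTMOn S) A.R (S.ι ⋙ mlfLogFrobeniusTFToTLG)

/-- **Prop 3.2 (v), the 1-factorization for `T′ = TCG`**: `𝔩𝔬𝔤_{TF,TCG}|_S ≅ (𝒞_TF → 𝒞_TM) ⋙ 𝔩𝔬𝔤_{TM,TCG}`.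
[cite: MochizukiAbsTopIII2015, Proposition 3.2 (v) p.72] -/
def factorTCG (A : Prop32iiiAlgorithm.{u} S) : S.ι ⋙ mlfLogFrobeniusTFToTCG.{u} ≅ tfToTMOn S ⋙ A.mlfLogFrobeniusTMToTCG :=
  (Functor.leftUnitor _).symm ≪≫ Functor.isoWhiskerRight A.unitIso.symm (S.ι ⋙ mlfLogFrobeniusTFToTCG) ≪≫
    Functor.associator (tfToTMOn S) A.R (S.ι ⋙ mlfLogFrobeniusTFToTCG)

/-- **Prop 3.2 (v): "the functor `𝔩𝔬𝔤_{T,T}` is isomorphic to the identity functor"** for `T = TM` (the counit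
of the algorithm of (iii)). [cite: MochizukiAbsTopIII2015, Proposition 3.2 (v) p.72] -/
def mlfLogFrobeniusTMToTMIsoId (A : Prop32iiiAlgorithm.{u} S) : A.mlfLogFrobeniusTMToTM ≅ 𝟭 _ := A.counitIso

/-- **Prop 3.2 (v): "hence, in particular, [`𝔩𝔬𝔤_{TM,TM}`] is an equivalence of categories".**
[cite: MochizukiAbsTopIII2015, Proposition 3.2 (v) p.72] -/
theorem isEquivalence_mlfLogFrobeniusTMToTM (A : Prop32iiiAlgorithm.{u} S) : A.mlfLogFrobeniusTMToTM.IsEquivalence :=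
  Functor.isEquivalence_of_iso A.mlfLogFrobeniusTMToTMIsoId.symm

/-- For `T = TF` "the first arrow is [...] the identity functor": the factorization of `𝔩𝔬𝔤_{TF,T′}` through
`𝒞_TF` is tautological (recorded to complete print's case list `T ∈ {TF, TM}`).
[cite: MochizukiAbsTopIII2015, Proposition 3.2 (v) p.72] -/
def factorThroughTF : mlfLogFrobeniusTFToTM.{u} ≅ 𝟭 _ ⋙ mlfLogFrobeniusTFToTM := (Functor.leftUnitor _).symm

end Prop32iiiAlgorithm

/-! ## (e) What the parameter amounts to: the algorithm of (iii) exists iff `𝒞^{S}_TF → 𝒞^{S}_TM` is full -/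

variable {S} in
/-- **From fullness to the algorithm of (iii)**: if every morphism of integer pairs between `S`-pairs extends
to the fields, then — `tfToTMOn S` being faithful and essentially surjective unconditionally — the natural
functor is an equivalence and its quasi-inverse IS a `Prop32iiiAlgorithm S` (Mathlib's `Functor.asEquivalence`).
[cite: MochizukiAbsTopIII2015, Proposition 3.2 (v) p.72] -/
def Prop32iiiAlgorithm.ofFull (h : (tfToTMOn S).Full) : Prop32iiiAlgorithm.{u} S :=
  haveI := h
  haveI := tfToTMOn_faithful.{u} S
  haveI := tfToTMOn_essSurj.{u} S
  haveI : (tfToTMOn S).IsEquivalence := {}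
  { R := (tfToTMOn S).asEquivalence.inverse
    unitIso := (tfToTMOn S).asEquivalence.unitIso.symm
    counitIso := (tfToTMOn S).asEquivalence.counitIso }

/-- **THE RESIDUAL OF Prop 3.2 (v) AT FUNCTOR LEVEL, kernel-pinned**: the algorithm of (iii) exists as a
functorial datum on the `S`-pairs IFF the natural functor `𝒞^{S}_TF → 𝒞^{S}_TM` is FULL ("every morphism
`(Π ↷ 𝒪^⊳) → (Π′ ↷ 𝒪′^⊳)` between `S`-pairs extends to the fields").  For `S` = "of strictly Belyi type" print
asserts this fullness via Cor 1.10 (h) (campaign-L, not asserted here); for mono-analytic pairs it fails.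
[cite: MochizukiAbsTopIII2015, Proposition 3.2 (v) p.72] -/
theorem nonempty_prop32iiiAlgorithm_iff_full : Nonempty (Prop32iiiAlgorithm.{u} S) ↔ (tfToTMOn S).Full :=
  ⟨fun ⟨A⟩ => A.full, fun h => ⟨Prop32iiiAlgorithm.ofFull h⟩⟩

/-- For `S = ⊤` (all MLF-Galois `TF`-pairs with compact `Π`) the category "`𝒞^{MLF-S}_TM`" is ALL of `𝒞^c_TM`
(`tfToTMCompact` is essentially surjective). [cite: MochizukiAbsTopIII2015, Definition 3.1 (iii) p.68] -/
theorem tmPairsOf_top (Q : MLFGaloisMonoidPairCompactCat.{u} .TM) : tmPairsOf ⊤ Q := by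
  haveI := tfToTMCompact_essSurj.{u}
  obtain ⟨P, ⟨i⟩⟩ := Functor.EssSurj.mem_essImage (F := tfToTMCompact) Q
  exact ⟨P, trivial, ⟨i⟩⟩

end Literature.AnabelianGeometry.AbsoluteAnabelian

end
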